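import Mathlib
import Summits.HodgeConjecture.HodgeConjecture.Theorems.HodgeLocusCensusUnitColumnRankD4
import Summits.HodgeConjecture.HodgeConjecture.Theorems.HodgeLocusCensusInclusionPowers
import Summits.HodgeConjecture.HodgeConjecture.Theorems.HodgeLocusCensusUnitColumnRankD4Levels
import Summits.HodgeConjecture.HodgeConjecture.Theorems.HodgeLocusCensusUnitColumnRankLevels
import Summits.HodgeConjecture.HodgeConjecture.Theorems.HodgeLocusCensusUnitColumnRankD3LevelsPowers

/-!
# THEOREM L for EVERY `d = e + 3 ≥ 3`, EVERY power `c′ = c`, EVERY level (characteristic `0`) — ENGINE B (gen 51 PROBE 6; gen 52 sheet)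

certified instances and evidence bearing on the general Hodge conjecture; no claim.

`B = K[x₁,…,x_k]/(xᵢ^{e+2})`, `q = Σ xᵢ^{e+1}` (THEOREM K-MODEL), anchor 174/179's convention with degree, power AND level freed: rows
`v : Fin k → Fin (e+2)` of codegree `j` (`Σ v + j = k(e+1)`), columns `m` of codegree `j + c(e+1)`, entry = the multiplicity of `List.ofFn v` in the
`c`-fold column expansion `(List.flatMap (colR (e+3)))^[c] [List.ofFn m]` (gen 31's `colR`; `c = 1`: `colR (e+3) (ofFn m)` by `List.flatMap_singleton`,
multiplicity = indicator by anchor 174's `indicator_eq_count_colR`; `c = 2, 3` at `e = 0`: anchor 220's nested `flatMap`s), cast `ℕ → K` = the matrix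
of `×q^c : B_{k(e+1)−j−c(e+1)} → B_{k(e+1)−j}`.  `rank_mulDeltaPow_levels`:
  `rank = Σ_{μ : Fin k → Fin (e+1)} [e+1 ∣ σ ∧ (e+1)s ≤ σ] · min (C(k−s, σ/(e+1) − s), C(k−s, σ/(e+1) − s + c))`,
  `σ = j + Σμ`, `s = #{μ ≠ 0}`.
Instances of record: anchors 199 / 174 / 191 / 219 / 222 (`c = 1`), 220 (`e = 0`, `c = 2, 3`), 204 (`e = 0`, every `c`, as set inclusions).
MECHANISM: (1) MULTIPLICITY IDENTITY `count_iterate_colR` (induction on `c`, generalising anchor 220's `count_colR2_ind`/`count_colR3_ind` to every `d`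
and `c`): the multiplicity of `x^v` in `q^c · x^m` (list form) is `c! · [labels equal ∧ Z(v) ⊆ Z(m) ∧ |Z(m)| = |Z(v)| + c]` — the `c` raised zeros
can be raised in any order (anchor 220's `sum_ind_erase` BY NAME; the column list has no duplicates, anchor 174 `colR_nodup`; `colR_toFinset` describes
it as the image of the zero set under `i ↦ ofFn (update m i (e+1))`); (2) hence labels (exponents mod `e+1`, anchor 222) are preserved and the matrix is
a direct sum over labels — anchor 219's `rank_eq_sum_rank_fiber_of` BY NAME; (3) on the fibre of `μ` (anchor 222's `exists_fiberEquiv`, `fiber_arith`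
BY NAME) the block is `c! •` the set-inclusion matrix `W^{(c)}_t` of the `(k−s)`-set `{x // μ x = 0}`, rank `min (C(k−s,t), C(k−s,t+c))` by anchor
220's `rank_smul_of_ne_zero` (`c! ≠ 0` in characteristic `0`) and anchor 204's `rank_incl_pow K t c` BY NAME.
Imports `Mathlib` + anchors 174 / 204 / 219 / 220 / 222 (`…UnitColumnRankLevels`) BY NAME; nothing restated; theorem-only, definition-free,
no `decide`.  Numerics: `gen51/check/levels_pow.py` → `levels_pow_d6k5c3.out`, 792/792 (d = 3..6, c = 0..3, k ≤ 5, every level: literal `colR`-iterate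
multiplicity matrices, exact ranks vs. this λ-form, four implementations; the multiplicity identity entry-wise).
Evidence-class material; no census number changes; nothing about HC.
-/

set_option linter.dupNamespace false
set_option autoImplicit false

namespace Summit.HodgeConjecture.HodgeConjecture.HodgeLocus.Census.UnitColumnRankLevelsPowers

open Summit.HodgeConjecture.HodgeConjecture.HodgeLocus.Census.ModelNonJumpC1All (colR)
open Summit.HodgeConjecture.HodgeConjecture.HodgeLocus.Census.UnitColumnRankD4 (mem_colR_iff colR_nodup)
open Summit.HodgeConjecture.HodgeConjecture.HodgeLocus.Census.InclusionPowers (rank_incl_pow)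
open Summit.HodgeConjecture.HodgeConjecture.HodgeLocus.Census.UnitColumnRankD4Levels (rank_eq_sum_rank_fiber_of)
open Summit.HodgeConjecture.HodgeConjecture.HodgeLocus.Census.UnitColumnRankLevels (fiber_arith exists_fiberEquiv)
open Summit.HodgeConjecture.HodgeConjecture.HodgeLocus.Census.UnitColumnRankD3LevelsPowers (sum_ind_erase rank_smul_of_ne_zero)
open Matrix Module

/-- iterating a flat-map distributes over the input list -/
theorem iterate_flatMap_eq (g : List ℕ → List (List ℕ)) (c : ℕ) (L : List (List ℕ)) :
    (List.flatMap g)^[c] L = L.flatMap (fun x => (List.flatMap g)^[c] [x]) := by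
  induction c generalizing L with
  | zero => simp only [Function.iterate_zero_apply, List.flatMap_singleton']
  | succ c ih =>
    calc (List.flatMap g)^[c + 1] L = (List.flatMap g)^[c] (List.flatMap g L) := by rw [Function.iterate_succ_apply]
      _ = (List.flatMap g L).flatMap (fun x => (List.flatMap g)^[c] [x]) := ih _
      _ = L.flatMap (fun y => (g y).flatMap (fun x => (List.flatMap g)^[c] [x])) := List.flatMap_assoc
      _ = L.flatMap (fun y => (List.flatMap g)^[c] (g y)) := by congr 1; funext y; exact (ih (g y)).symm
      _ = L.flatMap (fun y => (List.flatMap g)^[c + 1] [y]) := by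
          congr 1; funext y; rw [Function.iterate_succ_apply, List.flatMap_singleton]

/-- two exponent functions with the same labels (exponents mod `e+1`) and the same zero set are equal -/
theorem eq_of_labels_of_zeros {k e : ℕ} (m v : Fin k → Fin (e + 2)) (hlab : ∀ l, (v l : ℕ) % (e + 1) = (m l : ℕ) % (e + 1))
    (hZ : Finset.univ.filter (fun l => (v l : ℕ) = 0) = Finset.univ.filter (fun l => (m l : ℕ) = 0)) : v = m := by
  funext l
  apply Fin.ext
  have hiff : (v l : ℕ) = 0 ↔ (m l : ℕ) = 0 := by simpa using Finset.ext_iff.mp hZ l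
  by_cases hv0 : (v l : ℕ) = 0
  · rw [hv0, hiff.mp hv0]
  · have hm0 : (m l : ℕ) ≠ 0 := fun h => hv0 (hiff.mpr h)
    have h1 := hlab l
    have hvle : (v l : ℕ) ≤ e + 1 := by have := (v l).isLt; omega
    have hmle : (m l : ℕ) ≤ e + 1 := by have := (m l).isLt; omega
    by_cases hvt : (v l : ℕ) = e + 1
    · by_cases hmt : (m l : ℕ) = e + 1
      · rw [hvt, hmt]
      · rw [hvt, Nat.mod_self, Nat.mod_eq_of_lt (show (m l : ℕ) < e + 1 by omega)] at h1
        exact absurd h1.symm hm0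
    · by_cases hmt : (m l : ℕ) = e + 1
      · rw [hmt, Nat.mod_self, Nat.mod_eq_of_lt (show (v l : ℕ) < e + 1 by omega)] at h1
        exact absurd h1 hv0
      · rwa [Nat.mod_eq_of_lt (show (v l : ℕ) < e + 1 by omega), Nat.mod_eq_of_lt (show (m l : ℕ) < e + 1 by omega)] at h1

/-- raising coordinate `i` to the top exponent `e + 1`, in list form -/
theorem set_ofFn_eq {k e : ℕ} (m : Fin k → Fin (e + 2)) (i : Fin k) :
    (List.ofFn (fun l => (m l : ℕ))).set i (e + 1) = List.ofFn (fun l => ((Function.update m i (Fin.last (e + 1)) l : Fin (e + 2)) : ℕ)) := by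
  apply List.ext_getElem (by simp)
  intro n h1 h2
  simp only [List.getElem_set, List.getElem_ofFn, Function.update_apply]
  by_cases hin : (i : ℕ) = n
  · have hni : (⟨n, by simpa using h2⟩ : Fin k) = i := Fin.ext hin.symm
    rw [if_pos hin, if_pos hni, Fin.val_last]
  · have hni : ¬ ((⟨n, by simpa using h2⟩ : Fin k) = i) := fun h => hin (by rw [← h])
    rw [if_neg hin, if_neg hni]

/-- raising a zero coordinate keeps the labels and erases that zero -/
theorem update_facts {k e : ℕ} (m : Fin k → Fin (e + 2)) (i : Fin k) (hi : (m i : ℕ) = 0) :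
    (∀ l, ((Function.update m i (Fin.last (e + 1)) l : Fin (e + 2)) : ℕ) % (e + 1) = (m l : ℕ) % (e + 1)) ∧
    Finset.univ.filter (fun l => ((Function.update m i (Fin.last (e + 1)) l : Fin (e + 2)) : ℕ) = 0) =
      (Finset.univ.filter (fun l => (m l : ℕ) = 0)).erase i := by
  refine ⟨fun l => ?_, ?_⟩
  · rw [Function.update_apply]
    by_cases hl : l = i
    · rw [if_pos hl, hl, hi, Fin.val_last, Nat.mod_self, Nat.zero_mod]
    · rw [if_neg hl]
  · ext l
    simp only [Finset.mem_filter, Finset.mem_univ, true_and, Finset.mem_erase, Function.update_apply]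
    by_cases hl : l = i
    · rw [if_pos hl, Fin.val_last]
      exact ⟨fun h => absurd h (Nat.succ_ne_zero e), fun h => absurd hl h.1⟩
    · rw [if_neg hl]
      exact ⟨fun h => ⟨hl, h⟩, fun h => h.2⟩

/-- the column list of `x^m` (anchor 174 `mem_colR_iff`) is, without repetitions, the image of the zero set of `m` under raising -/
theorem colR_toFinset {k e : ℕ} (m : Fin k → Fin (e + 2)) :
    (colR (e + 3) (List.ofFn (fun l => (m l : ℕ)))).toFinset =
      (Finset.univ.filter (fun i : Fin k => (m i : ℕ) = 0)).image
        (fun i : Fin k => List.ofFn (fun l => ((Function.update m i (Fin.last (e + 1)) l : Fin (e + 2)) : ℕ))) := by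
  have h32 : e + 3 - 2 = e + 1 := rfl
  ext x
  rw [List.mem_toFinset, mem_colR_iff, Finset.mem_image]
  constructor
  · rintro ⟨i, hi, h0, hx⟩
    rw [List.length_ofFn] at hi
    refine ⟨⟨i, hi⟩, ?_, ?_⟩
    · simp only [Finset.mem_filter, Finset.mem_univ, true_and]
      simpa using h0
    · rw [h32] at hx
      rw [hx]
      exact (set_ofFn_eq m ⟨i, hi⟩).symm
  · rintro ⟨i, hi, hx⟩
    simp only [Finset.mem_filter, Finset.mem_univ, true_and] at hi
    refine ⟨i, by simp, by simpa using hi, ?_⟩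
    rw [← hx, h32]
    exact (set_ofFn_eq m i).symm

/-- MULTIPLICITY IDENTITY: the multiplicity of `x^v` in `q^c · x^m`, in list form, is `c! · [labels equal ∧ Z(v) ⊆ Z(m) ∧ |Z(m)| = |Z(v)| + c]` -/
theorem count_iterate_colR {k e : ℕ} (c : ℕ) : ∀ (m v : Fin k → Fin (e + 2)),
    ((List.flatMap (colR (e + 3)))^[c] [List.ofFn (fun l => (m l : ℕ))]).count (List.ofFn (fun l => (v l : ℕ))) =
      if (∀ l, (v l : ℕ) % (e + 1) = (m l : ℕ) % (e + 1)) ∧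
          Finset.univ.filter (fun l => (v l : ℕ) = 0) ⊆ Finset.univ.filter (fun l => (m l : ℕ) = 0) ∧
          (Finset.univ.filter (fun l => (m l : ℕ) = 0)).card = (Finset.univ.filter (fun l => (v l : ℕ) = 0)).card + c
      then c.factorial else 0 := by
  induction c with
  | zero =>
    intro m v
    rw [Function.iterate_zero_apply]
    simp only [Nat.factorial_zero, Nat.add_zero]
    by_cases h : (∀ l, (v l : ℕ) % (e + 1) = (m l : ℕ) % (e + 1)) ∧
        Finset.univ.filter (fun l => (v l : ℕ) = 0) ⊆ Finset.univ.filter (fun l => (m l : ℕ) = 0) ∧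
        (Finset.univ.filter (fun l => (m l : ℕ) = 0)).card = (Finset.univ.filter (fun l => (v l : ℕ) = 0)).card
    · rw [if_pos h, eq_of_labels_of_zeros m v h.1 (Finset.eq_of_subset_of_card_le h.2.1 h.2.2.le)]
      exact List.count_singleton_self
    · rw [if_neg h]
      refine List.count_eq_zero.mpr (fun hmem => h ?_)
      have hvm : v = m := by
        have h1 := List.ofFn_inj.mp (List.mem_singleton.mp hmem)
        funext l
        exact Fin.ext (congrFun h1 l)
      subst hvm
      exact ⟨fun l => rfl, Finset.Subset.refl _, rfl⟩
  | succ c ih =>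
    intro m v
    rw [Function.iterate_succ_apply, List.flatMap_singleton, iterate_flatMap_eq, List.count_flatMap,
      ← List.sum_toFinset _ (colR_nodup (e + 3) (by omega) _), colR_toFinset, Finset.sum_image]
    · simp only [Function.comp_apply]
      rw [Finset.sum_congr rfl (fun i _ => ih (Function.update m i (Fin.last (e + 1))) v)]
      have hre : ∀ i ∈ Finset.univ.filter (fun l => (m l : ℕ) = 0),
          (if (∀ l, (v l : ℕ) % (e + 1) = ((Function.update m i (Fin.last (e + 1)) l : Fin (e + 2)) : ℕ) % (e + 1)) ∧
              Finset.univ.filter (fun l => (v l : ℕ) = 0) ⊆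
                Finset.univ.filter (fun l => ((Function.update m i (Fin.last (e + 1)) l : Fin (e + 2)) : ℕ) = 0) ∧
              (Finset.univ.filter (fun l => ((Function.update m i (Fin.last (e + 1)) l : Fin (e + 2)) : ℕ) = 0)).card =
                (Finset.univ.filter (fun l => (v l : ℕ) = 0)).card + c
            then c.factorial else 0) =
          if (∀ l, (v l : ℕ) % (e + 1) = (m l : ℕ) % (e + 1)) ∧
              (Finset.univ.filter (fun l => (v l : ℕ) = 0) ⊆ (Finset.univ.filter (fun l => (m l : ℕ) = 0)).erase i ∧
              ((Finset.univ.filter (fun l => (m l : ℕ) = 0)).erase i).card = (Finset.univ.filter (fun l => (v l : ℕ) = 0)).card + c)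
            then c.factorial else 0 := by
        intro i hi
        simp only [Finset.mem_filter, Finset.mem_univ, true_and] at hi
        obtain ⟨hlabi, hZi⟩ := update_facts m i hi
        rw [hZi]
        exact if_congr (and_congr (forall_congr' (fun l => by rw [hlabi l])) Iff.rfl) rfl rfl
      rw [Finset.sum_congr rfl hre]
      by_cases hlab : ∀ l, (v l : ℕ) % (e + 1) = (m l : ℕ) % (e + 1)
      · rw [Finset.sum_congr rfl (fun i _ => if_congr (and_iff_right hlab) rfl rfl), sum_ind_erase,
          if_congr (and_iff_right hlab) rfl rfl, Nat.factorial_succ]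
      · rw [Finset.sum_eq_zero (fun i _ => if_neg (fun h => hlab h.1)), if_neg (fun h => hlab h.1)]
    · intro i hi i' hi' h
      rw [Finset.coe_filter] at hi
      have h0 : (m i : ℕ) = 0 := hi.2
      have hf := congrFun (List.ofFn_inj.mp h) i
      by_contra hne
      rw [Function.update_apply, Function.update_apply, if_pos rfl, if_neg hne, Fin.val_last, h0] at hf
      exact Nat.succ_ne_zero e hf

/-- THE BLOCK OF A FEASIBLE LABEL `μ` (`j + Σμ = (e+1)(t + s)`): `c! •` the set-inclusion matrix `W^{(c)}_t` of the `(k − s)`-set `{x // μ x = 0}`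
up to reindexing; rank `min (C(k−s,t), C(k−s,t+c))` by anchor 220's `rank_smul_of_ne_zero` and anchor 204's `rank_incl_pow K t c` -/
theorem rank_fiber_pow (K : Type*) [Field K] [CharZero K] (k e c j : ℕ) (μ : Fin k → Fin (e + 1)) (t : ℕ)
    (hj : j + ∑ i, (μ i : ℕ) = (e + 1) * (t + (Finset.univ.filter (fun l => (μ l : ℕ) ≠ 0)).card)) :
    (Matrix.of fun (r : {r : {v : Fin k → Fin (e + 2) // (∑ i, (v i : ℕ)) + j = k * (e + 1)} // ∀ l, (r.1 l : ℕ) % (e + 1) = (μ l : ℕ)})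
        (q : {q : {m : Fin k → Fin (e + 2) // (∑ i, (m i : ℕ)) + (j + c * (e + 1)) = k * (e + 1)} //
          ∀ l, (q.1 l : ℕ) % (e + 1) = (μ l : ℕ)}) =>
      ((((List.flatMap (colR (e + 3)))^[c] [List.ofFn (fun i => (q.1.1 i : ℕ))]).count (List.ofFn (fun i => (r.1.1 i : ℕ))) : ℕ) : K)).rank =
      min ((k - (Finset.univ.filter (fun l => (μ l : ℕ) ≠ 0)).card).choose t)
        ((k - (Finset.univ.filter (fun l => (μ l : ℕ) ≠ 0)).card).choose (t + c)) := by
  obtain ⟨eR, heR⟩ := exists_fiberEquiv μ j t hj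
  obtain ⟨eC, heC⟩ := exists_fiberEquiv μ (j + c * (e + 1)) (t + c)
    (by rw [show (e + 1) * (t + c + (Finset.univ.filter (fun l => (μ l : ℕ) ≠ 0)).card) =
      (e + 1) * (t + (Finset.univ.filter (fun l => (μ l : ℕ) ≠ 0)).card) + c * (e + 1) by ring]; omega)
  have hα : Fintype.card {x : Fin k // (μ x : ℕ) = 0} = k - (Finset.univ.filter (fun l => (μ l : ℕ) ≠ 0)).card := by
    have h := Finset.card_filter_add_card_filter_not (s := (Finset.univ : Finset (Fin k))) (fun l => (μ l : ℕ) = 0)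
    rw [Fintype.card_subtype]
    simp only [Finset.card_univ, Fintype.card_fin, ne_eq] at h ⊢
    omega
  have hc : ((c.factorial : ℕ) : K) ≠ 0 := Nat.cast_ne_zero.mpr (Nat.factorial_ne_zero c)
  have key : (Matrix.of fun (r : {r : {v : Fin k → Fin (e + 2) // (∑ i, (v i : ℕ)) + j = k * (e + 1)} //
          ∀ l, (r.1 l : ℕ) % (e + 1) = (μ l : ℕ)})
        (q : {q : {m : Fin k → Fin (e + 2) // (∑ i, (m i : ℕ)) + (j + c * (e + 1)) = k * (e + 1)} //
          ∀ l, (q.1 l : ℕ) % (e + 1) = (μ l : ℕ)}) =>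
      ((((List.flatMap (colR (e + 3)))^[c] [List.ofFn (fun i => (q.1.1 i : ℕ))]).count (List.ofFn (fun i => (r.1.1 i : ℕ))) : ℕ) : K)) =
      Matrix.reindex eR.symm eC.symm (((c.factorial : ℕ) : K) • Matrix.of fun (T : {Z : Finset {x : Fin k // (μ x : ℕ) = 0} // Z.card = t})
        (U : {Z : Finset {x : Fin k // (μ x : ℕ) = 0} // Z.card = t + c}) => if T.1 ⊆ U.1 then (1 : K) else 0) := by
    ext r q
    simp only [Matrix.reindex_apply, Equiv.symm_symm, Matrix.submatrix_apply, Matrix.of_apply, Matrix.smul_apply, smul_eq_mul]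
    have hlab : ∀ l, (r.1.1 l : ℕ) % (e + 1) = (q.1.1 l : ℕ) % (e + 1) := fun l => (r.2 l).trans (q.2 l).symm
    rw [count_iterate_colR c q.1.1 r.1.1]
    by_cases hTU : (eR r).1 ⊆ (eC q).1
    · have hsub : Finset.univ.filter (fun l => (r.1.1 l : ℕ) = 0) ⊆ Finset.univ.filter (fun l => (q.1.1 l : ℕ) = 0) := by
        rw [← heR r, ← heC q]; exact Finset.map_subset_map.mpr hTU
      have hcard : (Finset.univ.filter (fun l => (q.1.1 l : ℕ) = 0)).card = (Finset.univ.filter (fun l => (r.1.1 l : ℕ) = 0)).card + c := by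
        rw [← heR r, ← heC q, Finset.card_map, Finset.card_map, (eR r).2, (eC q).2]
      rw [if_pos ⟨hlab, hsub, hcard⟩, if_pos hTU, mul_one]
    · rw [if_neg (fun h => hTU (Finset.map_subset_map.mp (by rw [heR r, heC q]; exact h.2.1))), if_neg hTU, mul_zero, Nat.cast_zero]
  rw [key, Matrix.rank_reindex, rank_smul_of_ne_zero _ _ hc, rank_incl_pow K (α := {x : Fin k // (μ x : ℕ) = 0}) t c, hα]

/-- an INFEASIBLE label (`e+1 ∤ j + Σμ` or `j + Σμ < (e+1)s`) has no rows at codegree `j`: block rank `0` -/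
theorem rank_fiber_pow_zero (K : Type*) [Field K] (k e c j : ℕ) (μ : Fin k → Fin (e + 1))
    (h : ¬ ((e + 1) ∣ (j + ∑ i, (μ i : ℕ)) ∧ (e + 1) * (Finset.univ.filter (fun l => (μ l : ℕ) ≠ 0)).card ≤ j + ∑ i, (μ i : ℕ))) :
    (Matrix.of fun (r : {r : {v : Fin k → Fin (e + 2) // (∑ i, (v i : ℕ)) + j = k * (e + 1)} // ∀ l, (r.1 l : ℕ) % (e + 1) = (μ l : ℕ)})
        (q : {q : {m : Fin k → Fin (e + 2) // (∑ i, (m i : ℕ)) + (j + c * (e + 1)) = k * (e + 1)} //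
          ∀ l, (q.1 l : ℕ) % (e + 1) = (μ l : ℕ)}) =>
      ((((List.flatMap (colR (e + 3)))^[c] [List.ofFn (fun i => (q.1.1 i : ℕ))]).count (List.ofFn (fun i => (r.1.1 i : ℕ))) : ℕ) : K)).rank =
      0 := by
  haveI : IsEmpty {r : {v : Fin k → Fin (e + 2) // (∑ i, (v i : ℕ)) + j = k * (e + 1)} // ∀ l, (r.1 l : ℕ) % (e + 1) = (μ l : ℕ)} :=
    ⟨fun r => h (by
      have h1 := fiber_arith μ r.1.1 r.1.2 r.2
      exact ⟨⟨_, h1⟩, by rw [h1]; exact Nat.mul_le_mul_left _ (Nat.le_add_left _ _)⟩)⟩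
  have hle := Matrix.rank_le_card_height (Matrix.of fun
      (r : {r : {v : Fin k → Fin (e + 2) // (∑ i, (v i : ℕ)) + j = k * (e + 1)} // ∀ l, (r.1 l : ℕ) % (e + 1) = (μ l : ℕ)})
      (q : {q : {m : Fin k → Fin (e + 2) // (∑ i, (m i : ℕ)) + (j + c * (e + 1)) = k * (e + 1)} //
        ∀ l, (q.1 l : ℕ) % (e + 1) = (μ l : ℕ)}) =>
      ((((List.flatMap (colR (e + 3)))^[c] [List.ofFn (fun i => (q.1.1 i : ℕ))]).count (List.ofFn (fun i => (r.1.1 i : ℕ))) : ℕ) : K))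
  rw [Fintype.card_eq_zero] at hle
  omega

/-- THE BLOCK OF A LABEL `μ` in the engine's fibre form (anchor 219), transported to the arithmetic fibre: rank
`[e+1 ∣ σ ∧ (e+1)s ≤ σ] · min (C(k−s, σ/(e+1) − s), C(k−s, σ/(e+1) − s + c))`, `σ = j + Σμ` -/
theorem rank_block_pow (K : Type*) [Field K] [CharZero K] (k e c j : ℕ) (μ : Fin k → Fin (e + 1)) :
    (Matrix.of fun (r : {r : {v : Fin k → Fin (e + 2) // (∑ i, (v i : ℕ)) + j = k * (e + 1)} //
          (fun l => (⟨(r.1 l : ℕ) % (e + 1), Nat.mod_lt _ (Nat.succ_pos e)⟩ : Fin (e + 1))) = μ})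
        (q : {q : {m : Fin k → Fin (e + 2) // (∑ i, (m i : ℕ)) + (j + c * (e + 1)) = k * (e + 1)} //
          (fun l => (⟨(q.1 l : ℕ) % (e + 1), Nat.mod_lt _ (Nat.succ_pos e)⟩ : Fin (e + 1))) = μ}) =>
      ((((List.flatMap (colR (e + 3)))^[c] [List.ofFn (fun i => (q.1.1 i : ℕ))]).count (List.ofFn (fun i => (r.1.1 i : ℕ))) : ℕ) : K)).rank =
      (if (e + 1) ∣ (j + ∑ i, (μ i : ℕ)) ∧ (e + 1) * (Finset.univ.filter (fun l => (μ l : ℕ) ≠ 0)).card ≤ j + ∑ i, (μ i : ℕ) then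
          min ((k - (Finset.univ.filter (fun l => (μ l : ℕ) ≠ 0)).card).choose
                ((j + ∑ i, (μ i : ℕ)) / (e + 1) - (Finset.univ.filter (fun l => (μ l : ℕ) ≠ 0)).card))
            ((k - (Finset.univ.filter (fun l => (μ l : ℕ) ≠ 0)).card).choose
                ((j + ∑ i, (μ i : ℕ)) / (e + 1) - (Finset.univ.filter (fun l => (μ l : ℕ) ≠ 0)).card + c))
        else 0) := by
  have hiff : ∀ w : Fin k → Fin (e + 2), ((fun l => (⟨(w l : ℕ) % (e + 1), Nat.mod_lt _ (Nat.succ_pos e)⟩ : Fin (e + 1))) = μ) ↔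
      ∀ l, (w l : ℕ) % (e + 1) = (μ l : ℕ) := fun w =>
    ⟨fun h l => Fin.ext_iff.mp (congrFun h l), fun h => funext fun l => Fin.ext (h l)⟩
  have key : (Matrix.of fun (r : {r : {v : Fin k → Fin (e + 2) // (∑ i, (v i : ℕ)) + j = k * (e + 1)} //
          (fun l => (⟨(r.1 l : ℕ) % (e + 1), Nat.mod_lt _ (Nat.succ_pos e)⟩ : Fin (e + 1))) = μ})
        (q : {q : {m : Fin k → Fin (e + 2) // (∑ i, (m i : ℕ)) + (j + c * (e + 1)) = k * (e + 1)} //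
          (fun l => (⟨(q.1 l : ℕ) % (e + 1), Nat.mod_lt _ (Nat.succ_pos e)⟩ : Fin (e + 1))) = μ}) =>
      ((((List.flatMap (colR (e + 3)))^[c] [List.ofFn (fun i => (q.1.1 i : ℕ))]).count (List.ofFn (fun i => (r.1.1 i : ℕ))) : ℕ) : K)) =
      Matrix.reindex
        (Equiv.subtypeEquivRight (fun (r : {v : Fin k → Fin (e + 2) // (∑ i, (v i : ℕ)) + j = k * (e + 1)}) => hiff r.1)).symm
        (Equiv.subtypeEquivRight
          (fun (q : {m : Fin k → Fin (e + 2) // (∑ i, (m i : ℕ)) + (j + c * (e + 1)) = k * (e + 1)}) => hiff q.1)).symm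
        (Matrix.of fun (r : {r : {v : Fin k → Fin (e + 2) // (∑ i, (v i : ℕ)) + j = k * (e + 1)} //
            ∀ l, (r.1 l : ℕ) % (e + 1) = (μ l : ℕ)})
          (q : {q : {m : Fin k → Fin (e + 2) // (∑ i, (m i : ℕ)) + (j + c * (e + 1)) = k * (e + 1)} //
            ∀ l, (q.1 l : ℕ) % (e + 1) = (μ l : ℕ)}) =>
          ((((List.flatMap (colR (e + 3)))^[c] [List.ofFn (fun i => (q.1.1 i : ℕ))]).count
            (List.ofFn (fun i => (r.1.1 i : ℕ))) : ℕ) : K)) := by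
    ext r q
    simp only [Matrix.reindex_apply, Equiv.symm_symm, Matrix.submatrix_apply, Matrix.of_apply, Equiv.subtypeEquivRight_apply_coe]
  rw [key, Matrix.rank_reindex]
  by_cases h : (e + 1) ∣ (j + ∑ i, (μ i : ℕ)) ∧ (e + 1) * (Finset.univ.filter (fun l => (μ l : ℕ) ≠ 0)).card ≤ j + ∑ i, (μ i : ℕ)
  · rw [if_pos h]
    obtain ⟨⟨a, ha⟩, hle⟩ := h
    rw [ha] at hle
    have has : (Finset.univ.filter (fun l => (μ l : ℕ) ≠ 0)).card ≤ a := Nat.le_of_mul_le_mul_left hle (Nat.succ_pos e)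
    rw [ha, Nat.mul_div_cancel_left a (Nat.succ_pos e)]
    exact rank_fiber_pow K k e c j μ (a - (Finset.univ.filter (fun l => (μ l : ℕ) ≠ 0)).card) (by rw [Nat.sub_add_cancel has]; exact ha)
  · rw [if_neg h]
    exact rank_fiber_pow_zero K k e c j μ h

/-- **THEOREM L, every `d = e + 3 ≥ 3`, every power `c`, every level** (`B = K[x₁,…,x_k]/(xᵢ^{e+2})`, `q = Σ xᵢ^{e+1}`, `char K = 0`), in anchor
174/220's convention: `rank (×q^c : B_{k(e+1)−j−c(e+1)} → B_{k(e+1)−j})`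
`= Σ_{μ : Fin k → Fin (e+1)} [e+1 ∣ σ ∧ (e+1)s ≤ σ] · min (C(k−s, σ/(e+1)−s), C(k−s, σ/(e+1)−s+c))`, `σ = j + Σμ`, `s = #{μ ≠ 0}`. -/
theorem rank_mulDeltaPow_levels (K : Type*) [Field K] [CharZero K] (k e c j : ℕ) :
    (Matrix.of fun (v : {v : Fin k → Fin (e + 2) // (∑ i, (v i : ℕ)) + j = k * (e + 1)})
        (m : {m : Fin k → Fin (e + 2) // (∑ i, (m i : ℕ)) + (j + c * (e + 1)) = k * (e + 1)}) =>
      ((((List.flatMap (colR (e + 3)))^[c] [List.ofFn (fun i => (m.1 i : ℕ))]).count (List.ofFn (fun i => (v.1 i : ℕ))) : ℕ) : K)).rank =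
      ∑ μ : Fin k → Fin (e + 1),
        (if (e + 1) ∣ (j + ∑ i, (μ i : ℕ)) ∧ (e + 1) * (Finset.univ.filter (fun l => (μ l : ℕ) ≠ 0)).card ≤ j + ∑ i, (μ i : ℕ) then
            min ((k - (Finset.univ.filter (fun l => (μ l : ℕ) ≠ 0)).card).choose
                  ((j + ∑ i, (μ i : ℕ)) / (e + 1) - (Finset.univ.filter (fun l => (μ l : ℕ) ≠ 0)).card))
              ((k - (Finset.univ.filter (fun l => (μ l : ℕ) ≠ 0)).card).choose
                  ((j + ∑ i, (μ i : ℕ)) / (e + 1) - (Finset.univ.filter (fun l => (μ l : ℕ) ≠ 0)).card + c))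
          else 0) := by
  rw [rank_eq_sum_rank_fiber_of (K := K) (ι := Fin k → Fin (e + 1))
    (fun (v : {v : Fin k → Fin (e + 2) // (∑ i, (v i : ℕ)) + j = k * (e + 1)})
        (m : {m : Fin k → Fin (e + 2) // (∑ i, (m i : ℕ)) + (j + c * (e + 1)) = k * (e + 1)}) =>
      ((((List.flatMap (colR (e + 3)))^[c] [List.ofFn (fun i => (m.1 i : ℕ))]).count (List.ofFn (fun i => (v.1 i : ℕ))) : ℕ) : K))
    (fun v l => (⟨(v.1 l : ℕ) % (e + 1), Nat.mod_lt _ (Nat.succ_pos e)⟩ : Fin (e + 1)))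
    (fun m l => (⟨(m.1 l : ℕ) % (e + 1), Nat.mod_lt _ (Nat.succ_pos e)⟩ : Fin (e + 1)))
    (fun v m hvm => by
      show ((((List.flatMap (colR (e + 3)))^[c] [List.ofFn (fun i => (m.1 i : ℕ))]).count
        (List.ofFn (fun i => (v.1 i : ℕ))) : ℕ) : K) = 0
      rw [count_iterate_colR c m.1 v.1, if_neg (fun h => hvm (funext fun l => Fin.ext (h.1 l))), Nat.cast_zero])]
  exact Finset.sum_congr rfl (fun μ _ => rank_block_pow K k e c j μ)

end Summit.HodgeConjecture.HodgeConjecture.HodgeLocus.Census.UnitColumnRankLevelsPowers
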